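import Summits.ResolutionOfSingularities.ResolutionOfSingularities.Theses.SyzygyFlattening
import Summits.ResolutionOfSingularities.ResolutionOfSingularities.Theorems.SyzygyFlatteningDefs
import Summits.ResolutionOfSingularities.ResolutionOfSingularities.Theorems.SyzygyFlatteningHigherRankTerminationTowerLocalisation
import Summits.ResolutionOfSingularities.ResolutionOfSingularities.Theorems.SyzygyFlatteningGlobalisationClosedPointDimZero
import Summits.ResolutionOfSingularities.ResolutionOfSingularities.Theorems.SyzygyFlatteningGlobalisationCentreChart
import Summits.ResolutionOfSingularities.ResolutionOfSingularities.Theorems.SyzygyFlatteningGlobalisationRegCentreOpen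
import Summits.ResolutionOfSingularities.ResolutionOfSingularities.Theorems.SyzygyFlatteningGlobalisationRegCentreGeneric
import Summits.ResolutionOfSingularities.ResolutionOfSingularities.Theorems.SyzygyFlatteningGlobalisationNormalizationStage
import Summits.ResolutionOfSingularities.ResolutionOfSingularities.Theorems.SyzygyFlatteningGlobalisationDatumBlowup
import Literature.AlgebraicGeometry.Resolution.ProperModelsRegModel
import Literature.AlgebraicGeometry.Resolution.ProperModelsModification
import Literature.AlgebraicGeometry.Resolution.ProperModelsFunctionField
import Literature.AlgebraicGeometry.Resolution.ZariskiFiniteness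
import Literature.AlgebraicGeometry.Resolution.AffineBlowupCartier
import Literature.AlgebraicGeometry.Resolution.Blowups
import Literature.AlgebraicGeometry.Resolution.ModuleBlowup
import Literature.AlgebraicGeometry.Resolution.SyzygySheaf
import HarnessLib

/-!
# Crux `Globalisation` (stmt-ResolutionOfSingularities-17061) — line `birth`, lead's skeleton (v3)

Route `ResolutionOfSingularities/SyzygyFlattening`, crux #4: `Globalisation` = "for every prime `p`:
termination of the syzygy-flattening tower along every dimension-zero valuation ring `O ⊇ A ⊇ k` of
every function field `K = Frac A` over every field `k` of characteristic `p` ⇒ `ResolutionInChar p`".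

## State of the line

Birth: `Globalisation ⇐ OneTower ∧ TowerCompactness`. v2 cut these into seven stubs; SIX HAVE LANDED
(imported above: `stub_closedPointDimZero`, `stub_centreChart`, `stub_regCentreOpen`,
`stub_regCentreGeneric`, `stub_normalizationStage`, `stub_datumBlowup`), and `towerCompactness`,
`oneStep`, `oneTower_of`, `Globalisation_of` are PROVED in this file. The valuation-local algebra of the
operator is the landed sibling line (`Theorems/SyzygyFlatteningDefs.lean`,
`…HigherRankTermination*.lean`: `stub_regularStep`, `stub_nrm_locAt`, `locAt_locAt`,
`stub_chart_canonical`, `stub_localizedDatum`, `stub_normIdeal_indep`, `stub_singIdeal_locAt`, …).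

What is left is v2's load-bearing `stub_syzygyBlowupStage` (the blow-up of a proper model at the syzygy
module of its non-regular locus, local rings at centres pinned to `locAt 𝒪_v (chart 𝒪_v B)`), which v3
cuts into five registered stubs (section `SyzygyStubs`) and PROVES from them (`syzygyBlowupStage`):
`stub_syzygyDatumExists` (a norm-ideal datum on each non-empty affine open), `stub_affineRes`
(restriction to a smaller affine open: injective, flat, non-regular locus restricts),
`stub_syzygyDatumCompat` (pure algebra: norm ideals of syzygy data agree up to scalars under flat base
change), `stub_syzygyDatumChart` (the verbatim chart, localised, is the blow-up chart `A[N/u₀]` of a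
minimal minor), `stub_datumBlowupStalk` (local rings of a glued datum blow-up at centres).

Disproof used: `Cruxes/Globalisation/Disproof.lean` (cdisprove): no `-- Targets` for this line; its
reading "the honest content is (ii): Zariski-locality of Φ + openness of Reg + RZ compactness" is this
cut; `A.FG` load-bearing is respected (the crux hypothesis is only applied to the f.g. chart `A`).
-/

noncomputable section

-- single-problem summit: the doubled namespace component `ResolutionOfSingularities` is forced
set_option linter.dupNamespace false

namespace Summit.ResolutionOfSingularities.ResolutionOfSingularities.Theorems.SyzygyFlattening

open CategoryTheory AlgebraicGeometry TopologicalSpace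
open Literature.AlgebraicGeometry
open Literature.AlgebraicGeometry.Resolution
open Summit.ResolutionOfSingularities.ResolutionOfSingularities.Theses.SyzygyFlattening (Globalisation)

universe u

/-! ## Local rings of a proper model inside `K` -/

/-- **The local ring of a proper model at `x`, realised in `K`**: the image of
`𝒪_{M,x} → 𝒪_{M,ξ} = K(M) ≅ K` (`ProperModel.funFieldIso`). [cite: ZariskiSamuel1960, Ch. VI §17] -/
abbrev stalkRange {k K : Type u} [Field k] [Field K] [Algebra k K] (M : ProperModel k K) (x : M.X) :
    Subring K :=
  ((M.X.presheaf.stalkSpecializes (genericPoint_specializes x) ≫ M.funFieldIso.hom).hom).range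

/-! ## Statements of the stubs by name (`Sig.stub_<name>`; the composition takes exactly these) -/


/-- Statement of `stub_closedPointDimZero`. [folklore] -/
def Sig.stub_closedPointDimZero : Prop := ∀ (k K : Type) [Field k] [Field K] [Algebra k K]
    (v : ZariskiRiemannSpace k K), IsClosed ({v} : Set (ZariskiRiemannSpace k K)) →
      DimZero k v.asValuationSubring

/-- Statement of `stub_centreChart`. [folklore] -/
def Sig.stub_centreChart : Prop := ∀ (k K : Type) [Field k] [Field K] [Algebra k K]
    (M : ProperModel k K) (v : ZariskiRiemannSpace k K) (U : M.X.Opens) (_hU : IsAffineOpen U)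
    (hx : M.centre v ∈ U),
    Function.Injective
        ((M.X.presheaf.stalkSpecializes (genericPoint_specializes (M.centre v)) ≫
          M.funFieldIso.hom).hom) ∧
      ∃ A : Subalgebra k K,
        (A : Set K) = Set.range
          (((M.X.presheaf.stalkSpecializes (genericPoint_specializes (M.centre v)) ≫
              M.funFieldIso.hom).hom).comp (M.X.presheaf.germ U (M.centre v) hx).hom) ∧
        A.FG ∧ IsFractionRing ↥A K ∧ A.toSubring ≤ v.asValuationSubring.toSubring ∧
        (locAt v.asValuationSubring A).toSubring =
          ((M.X.presheaf.stalkSpecializes (genericPoint_specializes (M.centre v)) ≫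
            M.funFieldIso.hom).hom).range

/-- Statement of `stub_regCentreOpen` (takes `Sig.stub_centreChart`). [folklore] -/
def Sig.stub_regCentreOpen : Prop := Sig.stub_centreChart → ∀ (k K : Type) [Field k] [Field K]
    [Algebra k K] (M : ProperModel k K), IsOpen {v : ZariskiRiemannSpace k K | M.RegCentre v}

/-- Statement of `stub_regCentreGeneric` (takes `Sig.stub_centreChart`). [folklore] -/
def Sig.stub_regCentreGeneric : Prop := Sig.stub_centreChart → ∀ (k K : Type) [Field k] [Field K]
    [Algebra k K] (M : ProperModel k K) (v w : ZariskiRiemannSpace k K),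
      v.asValuationSubring ≤ w.asValuationSubring → M.RegCentre v → M.RegCentre w

/-- Statement of `stub_datumBlowup`. [folklore] -/
def Sig.stub_datumBlowup : Prop := ∀ (k K : Type) [Field k] [Field K] [Algebra k K]
    (M : ProperModel k K) (N : ∀ U : M.X.affineOpens, Ideal Γ(M.X, U)),
      (∀ U : M.X.affineOpens, ((U : M.X.Opens) : Set M.X).Nonempty → N U ≠ ⊥) →
      (∀ (U V : M.X.affineOpens) (hVU : (V : M.X.Opens) ≤ (U : M.X.Opens)),
        ((V : M.X.Opens) : Set M.X).Nonempty →
        ∃ a b : Γ(M.X, V), a ≠ 0 ∧ b ≠ 0 ∧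
          Ideal.span {a} * N V =
            Ideal.span {b} * (N U).map (M.X.presheaf.map (homOfLE hVU).op).hom) →
      ∃ (Y : Scheme.{0}) (π : Y ⟶ M.X), IsIntegral Y ∧ IsProper π ∧
        ∀ U : M.X.affineOpens, ((U : M.X.Opens) : Set M.X).Nonempty →
          IsBlowup (π ∣_ (U : M.X.Opens) ≫ U.2.isoSpec.hom) (affineBlowup.idealSheaf (N U))

/-- Statement of `stub_syzygyBlowupStage` (takes `Sig.stub_centreChart`, `Sig.stub_datumBlowup`).
[folklore] -/
def Sig.stub_syzygyBlowupStage : Prop := Sig.stub_centreChart → Sig.stub_datumBlowup →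
    ∀ (k K : Type) [Field k] [Field K] [Algebra k K]
    (M : ProperModel k K), ∃ (M₁ : ProperModel k K) (_ : M₁.Hom M),
      ∀ (v : ZariskiRiemannSpace k K) (B : Subalgebra k K),
        B.toSubring = ((M.X.presheaf.stalkSpecializes (genericPoint_specializes (M.centre v)) ≫
            M.funFieldIso.hom).hom).range →
        (locAt v.asValuationSubring (chart v.asValuationSubring B)).toSubring =
          ((M₁.X.presheaf.stalkSpecializes (genericPoint_specializes (M₁.centre v)) ≫
            M₁.funFieldIso.hom).hom).range

/-- Statement of `stub_normalizationStage` (takes `Sig.stub_centreChart`). [folklore] -/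
def Sig.stub_normalizationStage : Prop := Sig.stub_centreChart →
    ∀ (k K : Type) [Field k] [Field K] [Algebra k K]
    (M : ProperModel k K), ∃ (M' : ProperModel k K) (_ : M'.Hom M),
      ∀ (v : ZariskiRiemannSpace k K) (C : Subalgebra k K),
        C.toSubring = ((M.X.presheaf.stalkSpecializes (genericPoint_specializes (M.centre v)) ≫
            M.funFieldIso.hom).hom).range →
        (locAt v.asValuationSubring (nrm C)).toSubring =
          ((M'.X.presheaf.stalkSpecializes (genericPoint_specializes (M'.centre v)) ≫
            M'.funFieldIso.hom).hom).range

/-! ## Registered stubs `stub_regCentreOpen`, `stub_regCentreGeneric`, `stub_closedPointDimZero`,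
`stub_centreChart`, `stub_datumBlowup`, `stub_normalizationStage`: LANDED (imported above). -/

/-! ## The registered stubs — the load-bearing `syzygyBlowupStage`, cut into five

Birth's `stub_oneTower` ⊃ v2's `stub_syzygyBlowupStage` (the blow-up of a proper model at the syzygy
module of its non-regular locus, with its local rings at centres pinned to `locAt 𝒪_v (chart 𝒪_v B)`) is
cut here into: the DATUM of norm ideals on the affine opens (`stub_syzygyDatumExists`), the passage to
smaller affine opens (`stub_affineRes`: injective, flat, the non-regular locus restricts) and the
pure-algebra compatibility of norm ideals of syzygy modules under flat base change
(`stub_syzygyDatumCompat`), the valuation-local identification of the verbatim chart with the blow-up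
chart `A[N/u₀]` (`stub_syzygyDatumChart`), and the generic description of the local rings of a glued
datum blow-up at centres (`stub_datumBlowupStalk`). `syzygyBlowupStage` below assembles them with the
LANDED `stub_datumBlowup` and `stub_centreChart`.

A "syzygy norm ideal datum" for a ring `R`, index `e`, ideal `J ⊆ R`: a finite free resolution `F` of
`R ⧸ J` (`FreeResolution`, `SyzygySheaf.lean`), an injective framing `φ : Ωₑ = F.syzygy e → R^r`
(`IsFraming`, `ModuleBlowup.lean`) and `N = normIdeal φ` (the ideal of maximal minors). The non-regular
locus ideal of `R` is `sInf {𝔭 : R_𝔭 not regular}` (verbatim the route's `J`, cf. `singIdeal`). -/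

section SyzygyStubs

variable {k K : Type} [Field k] [Field K] [Algebra k K]

/-- Statement of `stub_syzygyDatumExists`. [folklore] -/
def Sig.stub_syzygyDatumExists : Prop := ∀ (k K : Type) [Field k] [Field K] [Algebra k K]
    (M : ProperModel k K) (U : M.X.Opens) (_hU : IsAffineOpen U), ((U : Set M.X).Nonempty) →
      ∃ N : Ideal Γ(M.X, U), N ≠ ⊥ ∧
        ∃ (F : FreeResolution Γ(M.X, U) (Γ(M.X, U) ⧸
            sInf ((fun 𝔭 : PrimeSpectrum Γ(M.X, U) => 𝔭.asIdeal) ''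
              {𝔭 : PrimeSpectrum Γ(M.X, U) | ¬ IsRegularLocalRing (Localization.AtPrime 𝔭.asIdeal)})))
          (r : ℕ) (φ : ↥(F.syzygy (syzygyIndex k K - 1)) →ₗ[Γ(M.X, U)] (Fin r → Γ(M.X, U))),
          Function.Injective φ ∧ IsFraming φ ∧ N = normIdeal φ

/-- Statement of `stub_affineRes`. [folklore] -/
def Sig.stub_affineRes : Prop := ∀ (k K : Type) [Field k] [Field K] [Algebra k K]
    (M : ProperModel k K) (U V : M.X.Opens) (_hU : IsAffineOpen U) (_hV : IsAffineOpen V) (hVU : V ≤ U),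
      ((V : Set M.X).Nonempty) →
      Function.Injective (M.X.presheaf.map (homOfLE hVU).op).hom ∧
      (M.X.presheaf.map (homOfLE hVU).op).hom.Flat ∧
      sInf ((fun 𝔭 : PrimeSpectrum Γ(M.X, V) => 𝔭.asIdeal) ''
          {𝔭 : PrimeSpectrum Γ(M.X, V) | ¬ IsRegularLocalRing (Localization.AtPrime 𝔭.asIdeal)}) =
        (sInf ((fun 𝔭 : PrimeSpectrum Γ(M.X, U) => 𝔭.asIdeal) ''
          {𝔭 : PrimeSpectrum Γ(M.X, U) | ¬ IsRegularLocalRing (Localization.AtPrime 𝔭.asIdeal)})).map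
          (M.X.presheaf.map (homOfLE hVU).op).hom

/-- Statement of `stub_syzygyDatumCompat`. [folklore] -/
def Sig.stub_syzygyDatumCompat : Prop := ∀ (R S : Type) [CommRing R] [IsDomain R] [IsNoetherianRing R]
    [CommRing S] [IsDomain S] [IsNoetherianRing S] (f : R →+* S), Function.Injective f → f.Flat →
      ∀ (J : Ideal R) (e : ℕ) (N : Ideal R) (N' : Ideal S),
        (∃ (F : FreeResolution R (R ⧸ J)) (r : ℕ) (φ : ↥(F.syzygy e) →ₗ[R] (Fin r → R)),
          Function.Injective φ ∧ IsFraming φ ∧ N = normIdeal φ) →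
        (∃ (F' : FreeResolution S (S ⧸ J.map f)) (r' : ℕ) (φ' : ↥(F'.syzygy e) →ₗ[S] (Fin r' → S)),
          Function.Injective φ' ∧ IsFraming φ' ∧ N' = normIdeal φ') →
        ∃ a b : S, a ≠ 0 ∧ b ≠ 0 ∧ Ideal.span {a} * N' = Ideal.span {b} * N.map f

/-- Statement of `stub_syzygyDatumChart`. [folklore] -/
def Sig.stub_syzygyDatumChart : Prop := ∀ (k K : Type) [Field k] [Field K] [Algebra k K]
    (M : ProperModel k K) (v : ZariskiRiemannSpace k K) (U : M.X.Opens) (_hU : IsAffineOpen U)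
    (hx : M.centre v ∈ U) (B : Subalgebra k K),
      B.toSubring = ((M.X.presheaf.stalkSpecializes (genericPoint_specializes (M.centre v)) ≫
          M.funFieldIso.hom).hom).range →
      ∀ (N : Ideal Γ(M.X, U)),
        (∃ (F : FreeResolution Γ(M.X, U) (Γ(M.X, U) ⧸
            sInf ((fun 𝔭 : PrimeSpectrum Γ(M.X, U) => 𝔭.asIdeal) ''
              {𝔭 : PrimeSpectrum Γ(M.X, U) | ¬ IsRegularLocalRing (Localization.AtPrime 𝔭.asIdeal)})))
          (r : ℕ) (φ : ↥(F.syzygy (syzygyIndex k K - 1)) →ₗ[Γ(M.X, U)] (Fin r → Γ(M.X, U))),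
          Function.Injective φ ∧ IsFraming φ ∧ N = normIdeal φ) →
        ∀ u₀ ∈ N, u₀ ≠ 0 →
          let sec : Γ(M.X, U) →+* K :=
            ((M.X.presheaf.stalkSpecializes (genericPoint_specializes (M.centre v)) ≫
              M.funFieldIso.hom).hom).comp (M.X.presheaf.germ U (M.centre v) hx).hom
          (∀ n ∈ N, v.asValuationSubring.valuation (sec n) ≤ v.asValuationSubring.valuation (sec u₀)) →
          locAt v.asValuationSubring (chart v.asValuationSubring B) =
            locAt v.asValuationSubring (Algebra.adjoin k
              (Set.range sec ∪ {y : K | ∃ n ∈ N, y = sec n * (sec u₀)⁻¹}))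

/-- Statement of `stub_datumBlowupStalk`. [folklore] -/
def Sig.stub_datumBlowupStalk : Prop := ∀ (k K : Type) [Field k] [Field K] [Algebra k K]
    (M : ProperModel k K) (N : ∀ U : M.X.affineOpens, Ideal Γ(M.X, U)) (Y : Scheme.{0}) (π : Y ⟶ M.X),
      IsIntegral Y → IsProper π →
      (∀ U : M.X.affineOpens, ((U : M.X.Opens) : Set M.X).Nonempty → N U ≠ ⊥) →
      (∀ U : M.X.affineOpens, ((U : M.X.Opens) : Set M.X).Nonempty →
        IsBlowup (π ∣_ (U : M.X.Opens) ≫ U.2.isoSpec.hom) (affineBlowup.idealSheaf (N U))) →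
      ∃ (M₁ : ProperModel k K) (_ : M₁.Hom M),
        ∀ (v : ZariskiRiemannSpace k K) (U : M.X.Opens) (hU : IsAffineOpen U) (hx : M.centre v ∈ U)
          (u₀ : Γ(M.X, U)), u₀ ∈ N ⟨U, hU⟩ → u₀ ≠ 0 →
          let sec : Γ(M.X, U) →+* K :=
            ((M.X.presheaf.stalkSpecializes (genericPoint_specializes (M.centre v)) ≫
              M.funFieldIso.hom).hom).comp (M.X.presheaf.germ U (M.centre v) hx).hom
          (∀ n ∈ N ⟨U, hU⟩,
            v.asValuationSubring.valuation (sec n) ≤ v.asValuationSubring.valuation (sec u₀)) →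
          ((M₁.X.presheaf.stalkSpecializes (genericPoint_specializes (M₁.centre v)) ≫
              M₁.funFieldIso.hom).hom).range =
            (locAt v.asValuationSubring (Algebra.adjoin k
              (Set.range sec ∪ {y : K | ∃ n ∈ N ⟨U, hU⟩, y = sec n * (sec u₀)⁻¹}))).toSubring

/-- **STUB `stub_syzygyDatumExists`.** On a non-empty affine open `U` of a proper model, a syzygy norm
ideal datum for `Γ(M, U)` at the route's index (`e = n - 1`, `n = syzygyIndex k K`) and the ideal of the
non-regular locus exists, with non-zero norm ideal: `Γ(M, U)` is a Noetherian domain, `Γ(M,U) ⧸ J` has a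
finite free resolution (`FreeResolution.ofNoetherian`), the syzygy module (a submodule of a free module)
has a framing (`exists_isFraming`, injective by torsion-freeness), and `normIdeal φ ≠ ⊥`
(`IsFraming.normIdeal_ne_bot`). Pattern: `exists_minimalDatum_of_isNoetherianRing`
(…HigherRankTerminationExistsMinimalDatum.lean). [cite: Villamayoru2006, 3.4] -/
theorem stub_syzygyDatumExists : ∀ (k K : Type) [Field k] [Field K] [Algebra k K]
    (M : ProperModel k K) (U : M.X.Opens) (_hU : IsAffineOpen U), ((U : Set M.X).Nonempty) →
      ∃ N : Ideal Γ(M.X, U), N ≠ ⊥ ∧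
        ∃ (F : FreeResolution Γ(M.X, U) (Γ(M.X, U) ⧸
            sInf ((fun 𝔭 : PrimeSpectrum Γ(M.X, U) => 𝔭.asIdeal) ''
              {𝔭 : PrimeSpectrum Γ(M.X, U) | ¬ IsRegularLocalRing (Localization.AtPrime 𝔭.asIdeal)})))
          (r : ℕ) (φ : ↥(F.syzygy (syzygyIndex k K - 1)) →ₗ[Γ(M.X, U)] (Fin r → Γ(M.X, U))),
          Function.Injective φ ∧ IsFraming φ ∧ N = normIdeal φ := by
  sorry

/-- **STUB `stub_affineRes`.** For non-empty affine opens `V ⊆ U` of a proper model the restriction map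
`Γ(M, U) → Γ(M, V)` is injective (`M` integral), flat (an open immersion of affine schemes), and carries
the ideal of the non-regular locus of `Γ(M,U)` onto that of `Γ(M,V)` (the local rings of `Spec Γ(M,V)` are
those of `Spec Γ(M,U)` at the image points — both are stalks of `M` —, the regular locus is open, and the
extension of the radical ideal `J_U` stays radical since `Γ(M,V)/J_UΓ(M,V)` is locally `Γ(M,U)_𝔭/J_U`).
[cite: Matsumura1987, §30 Cor. to Thm. 30.5] -/
theorem stub_affineRes : ∀ (k K : Type) [Field k] [Field K] [Algebra k K]
    (M : ProperModel k K) (U V : M.X.Opens) (_hU : IsAffineOpen U) (_hV : IsAffineOpen V) (hVU : V ≤ U),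
      ((V : Set M.X).Nonempty) →
      Function.Injective (M.X.presheaf.map (homOfLE hVU).op).hom ∧
      (M.X.presheaf.map (homOfLE hVU).op).hom.Flat ∧
      sInf ((fun 𝔭 : PrimeSpectrum Γ(M.X, V) => 𝔭.asIdeal) ''
          {𝔭 : PrimeSpectrum Γ(M.X, V) | ¬ IsRegularLocalRing (Localization.AtPrime 𝔭.asIdeal)}) =
        (sInf ((fun 𝔭 : PrimeSpectrum Γ(M.X, U) => 𝔭.asIdeal) ''
          {𝔭 : PrimeSpectrum Γ(M.X, U) | ¬ IsRegularLocalRing (Localization.AtPrime 𝔭.asIdeal)})).map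
          (M.X.presheaf.map (homOfLE hVU).op).hom := by
  sorry

/-- **STUB `stub_syzygyDatumCompat` (pure commutative algebra).** Along a flat injective ring map
`f : R → S` of Noetherian domains, two syzygy norm ideal datums — one for `R ⧸ J` over `R`, one for
`S ⧸ JS` over `S`, same index — have norm ideals that agree up to non-zero scalars:
`a · N_S = b · N_R S`. Proof: base-change the `R`-resolution (`FreeResolution.baseChange`, `IsBaseChange`
of `R ⧸ J → S ⧸ JS`), the syzygy module (`isBaseChange_syzygyMap`) and the framing (its norm ideal
becomes `N_R S`, `normIdeal_eq_map_of_span_eq_top`; it stays injective with torsion cokernel by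
flatness/injectivity), then compare with the `S`-datum by `stub_normIdeal_indep` (Schanuel + free
summands + embeddings, landed) and clear the denominator of the constant.
[cite: Villamayoru2006, (2.0.1) and 3.4] -/
theorem stub_syzygyDatumCompat : ∀ (R S : Type) [CommRing R] [IsDomain R] [IsNoetherianRing R]
    [CommRing S] [IsDomain S] [IsNoetherianRing S] (f : R →+* S), Function.Injective f → f.Flat →
      ∀ (J : Ideal R) (e : ℕ) (N : Ideal R) (N' : Ideal S),
        (∃ (F : FreeResolution R (R ⧸ J)) (r : ℕ) (φ : ↥(F.syzygy e) →ₗ[R] (Fin r → R)),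
          Function.Injective φ ∧ IsFraming φ ∧ N = normIdeal φ) →
        (∃ (F' : FreeResolution S (S ⧸ J.map f)) (r' : ℕ) (φ' : ↥(F'.syzygy e) →ₗ[S] (Fin r' → S)),
          Function.Injective φ' ∧ IsFraming φ' ∧ N' = normIdeal φ') →
        ∃ a b : S, a ≠ 0 ∧ b ≠ 0 ∧ Ideal.span {a} * N' = Ideal.span {b} * N.map f := by
  sorry

/-- **STUB `stub_syzygyDatumChart` (the verbatim chart is the blow-up chart of a minimal minor).** For
`v ∈ Zar(K/k)` with centre `x ∈ U` (affine) on `M`, `B` the local ring of `M` at `x` realised in `K`,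
and a syzygy norm ideal datum `N ⊆ Γ(M, U)` at the route's index: for every non-zero `u₀ ∈ N` of minimal
`v`-value, `locAt 𝒪_v (chart 𝒪_v B) = locAt 𝒪_v (A[N/u₀])`, `A ⊆ K` the image of `Γ(M, U)`. Proof:
transport the datum along `Γ(M,U) ≅ A` (`stub_centreChart`: `B = locAt 𝒪_v A`), localise it at the
centre (`stub_localizedDatum`, `stub_singIdeal_locAt`), use the canonical form of the chart
(`stub_chart_canonical` with `indep_hyp`/`stub_normIdeal_indep`, or `locAt_step_eq`'s first half), and
`A[{det φg / det φx}] = A[N/det φx]`, `locAt 𝒪_v (A[N/u₀]) = locAt 𝒪_v (A[N/u₀'])` for two minimal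
`u₀, u₀'`. [cite: NovacoskiSpivakovsky2014, Def. 2.11; Villamayoru2006, 3.4] -/
theorem stub_syzygyDatumChart : ∀ (k K : Type) [Field k] [Field K] [Algebra k K]
    (M : ProperModel k K) (v : ZariskiRiemannSpace k K) (U : M.X.Opens) (_hU : IsAffineOpen U)
    (hx : M.centre v ∈ U) (B : Subalgebra k K),
      B.toSubring = ((M.X.presheaf.stalkSpecializes (genericPoint_specializes (M.centre v)) ≫
          M.funFieldIso.hom).hom).range →
      ∀ (N : Ideal Γ(M.X, U)),
        (∃ (F : FreeResolution Γ(M.X, U) (Γ(M.X, U) ⧸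
            sInf ((fun 𝔭 : PrimeSpectrum Γ(M.X, U) => 𝔭.asIdeal) ''
              {𝔭 : PrimeSpectrum Γ(M.X, U) | ¬ IsRegularLocalRing (Localization.AtPrime 𝔭.asIdeal)})))
          (r : ℕ) (φ : ↥(F.syzygy (syzygyIndex k K - 1)) →ₗ[Γ(M.X, U)] (Fin r → Γ(M.X, U))),
          Function.Injective φ ∧ IsFraming φ ∧ N = normIdeal φ) →
        ∀ u₀ ∈ N, u₀ ≠ 0 →
          let sec : Γ(M.X, U) →+* K :=
            ((M.X.presheaf.stalkSpecializes (genericPoint_specializes (M.centre v)) ≫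
              M.funFieldIso.hom).hom).comp (M.X.presheaf.germ U (M.centre v) hx).hom
          (∀ n ∈ N, v.asValuationSubring.valuation (sec n) ≤ v.asValuationSubring.valuation (sec u₀)) →
          locAt v.asValuationSubring (chart v.asValuationSubring B) =
            locAt v.asValuationSubring (Algebra.adjoin k
              (Set.range sec ∪ {y : K | ∃ n ∈ N, y = sec n * (sec u₀)⁻¹})) := by
  sorry

/-- **STUB `stub_datumBlowupStalk` (local rings of a glued datum blow-up at centres).** For a family
of ideals `N_U ⊆ Γ(M, U)` (non-zero on non-empty affine `U`) and a glued blow-up `π : Y → M` (`Y`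
integral, `π` proper, `IsBlowup` along `Ñ_U` over every non-empty affine `U` — the conclusion of
`stub_datumBlowup`): `π` is birational (an iso over `D(f)`, `f ∈ N_U ∖ 0`), so `Y` is a proper model
`M₁ → M` (`ProperModel.exists_properModel_of_isBirational`), and for `v` with centre `x ∈ U` on `M` and any
non-zero `u₀ ∈ N_U` of minimal `v`-value, the local ring of `M₁` at the centre of `v`, realised in `K`, is
`locAt 𝒪_v (A[N_U/u₀])` — the centre lies in some chart `D₊(u t) ≅ Spec A[N_U/u]` of
`π⁻¹U ≅ Bl_{N_U} Spec A` (`affineBlowup`, `reesChart`, `IsBlowup.unique`), its local ring is that chart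
ring localised at the centre (`stub_centreChart` for `M₁`), `𝒪_v ⊇ A[N_U/u]` forces `u` minimal, and two
minimal `u, u₀` give the same localisation. [cite: StacksProject, Tag 0804; NovacoskiSpivakovsky2014, Def. 2.11] -/
theorem stub_datumBlowupStalk : ∀ (k K : Type) [Field k] [Field K] [Algebra k K]
    (M : ProperModel k K) (N : ∀ U : M.X.affineOpens, Ideal Γ(M.X, U)) (Y : Scheme.{0}) (π : Y ⟶ M.X),
      IsIntegral Y → IsProper π →
      (∀ U : M.X.affineOpens, ((U : M.X.Opens) : Set M.X).Nonempty → N U ≠ ⊥) →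
      (∀ U : M.X.affineOpens, ((U : M.X.Opens) : Set M.X).Nonempty →
        IsBlowup (π ∣_ (U : M.X.Opens) ≫ U.2.isoSpec.hom) (affineBlowup.idealSheaf (N U))) →
      ∃ (M₁ : ProperModel k K) (_ : M₁.Hom M),
        ∀ (v : ZariskiRiemannSpace k K) (U : M.X.Opens) (hU : IsAffineOpen U) (hx : M.centre v ∈ U)
          (u₀ : Γ(M.X, U)), u₀ ∈ N ⟨U, hU⟩ → u₀ ≠ 0 →
          let sec : Γ(M.X, U) →+* K :=
            ((M.X.presheaf.stalkSpecializes (genericPoint_specializes (M.centre v)) ≫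
              M.funFieldIso.hom).hom).comp (M.X.presheaf.germ U (M.centre v) hx).hom
          (∀ n ∈ N ⟨U, hU⟩,
            v.asValuationSubring.valuation (sec n) ≤ v.asValuationSubring.valuation (sec u₀)) →
          ((M₁.X.presheaf.stalkSpecializes (genericPoint_specializes (M₁.centre v)) ≫
              M₁.funFieldIso.hom).hom).range =
            (locAt v.asValuationSubring (Algebra.adjoin k
              (Set.range sec ∪ {y : K | ∃ n ∈ N ⟨U, hU⟩, y = sec n * (sec u₀)⁻¹}))).toSubring := by
  sorry

/-! ### Assembly of `syzygyBlowupStage` from the five stubs and the landed gluing -/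

/-- A non-zero ideal of the sections of an affine chart containing the centre of `v` has a non-zero
element of minimal `v`-value (finite generation + `exists_max_valuation` on generators; values of
sections at the centre are `≤ 1`). [folklore] -/
theorem exists_minimal_mem (M : ProperModel k K) (v : ZariskiRiemannSpace k K) {U : M.X.Opens}
    (hU : IsAffineOpen U) (hx : M.centre v ∈ U) (N : Ideal Γ(M.X, U)) (hN : N ≠ ⊥) :
    ∃ u₀ ∈ N, u₀ ≠ 0 ∧ ∀ n ∈ N,
      v.asValuationSubring.valuation
          ((((M.X.presheaf.stalkSpecializes (genericPoint_specializes (M.centre v)) ≫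
            M.funFieldIso.hom).hom).comp (M.X.presheaf.germ U (M.centre v) hx).hom) n) ≤
        v.asValuationSubring.valuation
          ((((M.X.presheaf.stalkSpecializes (genericPoint_specializes (M.centre v)) ≫
            M.funFieldIso.hom).hom).comp (M.X.presheaf.germ U (M.centre v) hx).hom) u₀) := by
  classical
  let sec : Γ(M.X, U) →+* K :=
    ((M.X.presheaf.stalkSpecializes (genericPoint_specializes (M.centre v)) ≫
      M.funFieldIso.hom).hom).comp (M.X.presheaf.germ U (M.centre v) hx).hom
  let O := v.asValuationSubring
  show ∃ u₀ ∈ N, u₀ ≠ 0 ∧ ∀ n ∈ N, O.valuation (sec n) ≤ O.valuation (sec u₀)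
  -- sections have values `≤ 1`
  obtain ⟨-, A, hA, -, -, hAO, -⟩ := stub_centreChart k K M v U hU hx
  have hsecO : ∀ a : Γ(M.X, U), sec a ∈ O := fun a =>
    hAO (show sec a ∈ A from by rw [← SetLike.mem_coe, hA]; exact ⟨a, rfl⟩)
  have hle1 : ∀ a : Γ(M.X, U), O.valuation (sec a) ≤ 1 := fun a =>
    (O.valuation_le_one_iff _).mpr (hsecO a)
  -- a finite generating set with a non-zero member
  haveI : IsNoetherianRing Γ(M.X, U) :=
    IsLocallyNoetherian.component_noetherian (⟨U, hU⟩ : M.X.affineOpens)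
  obtain ⟨t, ht⟩ := (IsNoetherian.noetherian N : N.FG)
  have hne : ∃ g ∈ t, sec g ≠ 0 := by
    by_contra! hcon
    apply hN
    rw [← ht, Ideal.span_eq_bot]
    intro g hg
    have hinj : Function.Injective sec := by
      change Function.Injective ((((M.X.presheaf.stalkSpecializes
        (genericPoint_specializes (M.centre v)) ≫ M.funFieldIso.hom).hom)) ∘
        (M.X.presheaf.germ U (M.centre v) hx).hom)
      exact (centreChart_stalkToK_injective M (M.centre v)).comp
        (AlgebraicGeometry.germ_injective_of_isIntegral M.X (M.centre v) hx)
    exact hinj (by rw [hcon g hg, map_zero])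
  obtain ⟨u₀, hu₀t, hu₀0, hmax⟩ := exists_max_valuation O t (fun g => sec g) hne
  refine ⟨u₀, ht ▸ Ideal.subset_span hu₀t, fun h => hu₀0 (by rw [h, map_zero]), ?_⟩
  intro n hn
  rw [← ht] at hn
  refine Submodule.span_induction (p := fun n _ => O.valuation (sec n) ≤ O.valuation (sec u₀))
    ?_ ?_ ?_ ?_ hn
  · exact fun g hg => hmax g hg
  · simp
  · intro x y _ _ hx' hy'
    rw [map_add]
    exact Valuation.map_add_le _ hx' hy'
  · intro c x _ hx'
    rw [smul_eq_mul, map_mul, map_mul]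
    calc O.valuation (sec c) * O.valuation (sec x)
        ≤ 1 * O.valuation (sec u₀) := mul_le_mul' (hle1 c) hx'
      _ = O.valuation (sec u₀) := one_mul _

/-- **The syzygy blow-up stage** (v2's registered `stub_syzygyBlowupStage`, now a theorem modulo the
five stubs above): choose a syzygy norm ideal datum on every non-empty affine open
(`stub_syzygyDatumExists`); they are compatible up to scalars (`stub_affineRes` + `stub_syzygyDatumCompat`),
so they glue to a proper birational `π : Y → M` (`stub_datumBlowup`, landed) and a proper model `M₁ → M`
whose local ring at the centre of `v` is `locAt 𝒪_v (A[N_U/u₀])` (`stub_datumBlowupStalk`)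
`= locAt 𝒪_v (chart 𝒪_v B)` (`stub_syzygyDatumChart`). [cite: Villamayoru2006, Thm. 3.3 and 3.4] -/
theorem syzygyBlowupStage_of (t₁ : Sig.stub_syzygyDatumExists) (t₂ : Sig.stub_affineRes)
    (t₃ : Sig.stub_syzygyDatumCompat) (t₄ : Sig.stub_syzygyDatumChart) (t₅ : Sig.stub_datumBlowupStalk) :
    Sig.stub_syzygyBlowupStage := by
  intro _h₄ h₇ k K _ _ _ M
  classical
  -- the ideal of the non-regular locus and the datum property, by affine open
  let J : ∀ U : M.X.affineOpens, Ideal Γ(M.X, U) := fun U =>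
    sInf ((fun 𝔭 : PrimeSpectrum Γ(M.X, U) => 𝔭.asIdeal) ''
      {𝔭 : PrimeSpectrum Γ(M.X, U) | ¬ IsRegularLocalRing (Localization.AtPrime 𝔭.asIdeal)})
  let P : ∀ U : M.X.affineOpens, Ideal Γ(M.X, U) → Prop := fun U N =>
    ∃ (F : FreeResolution Γ(M.X, U) (Γ(M.X, U) ⧸ J U)) (r : ℕ)
      (φ : ↥(F.syzygy (syzygyIndex k K - 1)) →ₗ[Γ(M.X, U)] (Fin r → Γ(M.X, U))),
      Function.Injective φ ∧ IsFraming φ ∧ N = normIdeal φ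
  have hex : ∀ U : M.X.affineOpens, ((U : M.X.Opens) : Set M.X).Nonempty →
      ∃ N : Ideal Γ(M.X, U), N ≠ ⊥ ∧ P U N :=
    fun U hU => t₁ k K M U U.2 hU
  -- the datum (and `⊥` on empty affine opens)
  let N : ∀ U : M.X.affineOpens, Ideal Γ(M.X, U) := fun U =>
    if hU : ((U : M.X.Opens) : Set M.X).Nonempty then (hex U hU).choose else ⊥
  have hN : ∀ (U : M.X.affineOpens) (hU : ((U : M.X.Opens) : Set M.X).Nonempty),
      N U ≠ ⊥ ∧ P U (N U) := by
    intro U hU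
    have : N U = (hex U hU).choose := dif_pos hU
    rw [this]
    exact (hex U hU).choose_spec
  have h0 : ∀ U : M.X.affineOpens, ((U : M.X.Opens) : Set M.X).Nonempty → N U ≠ ⊥ :=
    fun U hU => (hN U hU).1
  -- compatibility up to scalars on smaller affine opens
  have hc : ∀ (U V : M.X.affineOpens) (hVU : (V : M.X.Opens) ≤ (U : M.X.Opens)),
      ((V : M.X.Opens) : Set M.X).Nonempty →
      ∃ a b : Γ(M.X, V), a ≠ 0 ∧ b ≠ 0 ∧
        Ideal.span {a} * N V =
          Ideal.span {b} * (N U).map (M.X.presheaf.map (homOfLE hVU).op).hom := by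
    intro U V hVU hV
    have hU' : ((U : M.X.Opens) : Set M.X).Nonempty := hV.mono hVU
    obtain ⟨hinj, hflat, hJ⟩ := t₂ k K M U V U.2 V.2 hVU hV
    obtain ⟨-, hPU⟩ := hN U hU'
    obtain ⟨-, hPV⟩ := hN V hV
    haveI : Nonempty (V : M.X.Opens) := ⟨⟨_, hV.some_mem⟩⟩
    haveI : Nonempty (U : M.X.Opens) := ⟨⟨_, hU'.some_mem⟩⟩
    haveI : IsNoetherianRing Γ(M.X, U) := IsLocallyNoetherian.component_noetherian U
    haveI : IsNoetherianRing Γ(M.X, V) := IsLocallyNoetherian.component_noetherian V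
    have hPV' : ∃ (F' : FreeResolution Γ(M.X, V) (Γ(M.X, V) ⧸ (J U).map
        (M.X.presheaf.map (homOfLE hVU).op).hom)) (r' : ℕ)
        (φ' : ↥(F'.syzygy (syzygyIndex k K - 1)) →ₗ[Γ(M.X, V)] (Fin r' → Γ(M.X, V))),
        Function.Injective φ' ∧ IsFraming φ' ∧ N V = normIdeal φ' := by
      have hJ' : J V = (J U).map (M.X.presheaf.map (homOfLE hVU).op).hom := hJ
      rw [← hJ']
      exact hPV
    exact t₃ Γ(M.X, U) Γ(M.X, V) (M.X.presheaf.map (homOfLE hVU).op).hom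
      hinj hflat (J U) (syzygyIndex k K - 1) (N U) (N V) hPU hPV'
  -- glue, package, and read off the local rings at centres
  obtain ⟨Y, π, hY, hπ, hblow⟩ := h₇ k K M N h0 hc
  obtain ⟨M₁, φ₁, hst⟩ := t₅ k K M N Y π hY hπ h0 hblow
  refine ⟨M₁, φ₁, fun v B hB => ?_⟩
  obtain ⟨_, ⟨U, hU, rfl⟩, hxU, -⟩ :=
    M.X.isBasis_affineOpens.exists_subset_of_mem_open (Set.mem_univ (M.centre v)) isOpen_univ
  have hUne : ((U : M.X.Opens) : Set M.X).Nonempty := ⟨_, hxU⟩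
  obtain ⟨hNU, hPU⟩ := hN ⟨U, hU⟩ hUne
  obtain ⟨u₀, hu₀N, hu₀0, hmin⟩ := exists_minimal_mem M v hU hxU (N ⟨U, hU⟩) hNU
  have e1 := t₄ k K M v U hU hxU B hB (N ⟨U, hU⟩) hPU u₀ hu₀N hu₀0 hmin
  have e2 := hst v U hU hxU u₀ hu₀N hu₀0 hmin
  rw [e1]
  exact e2.symm

end SyzygyStubs

/-! ## TowerCompactness, PROVED from the three Zariski-space stubs -/

/-- The composite domination `N m → M` of a tower `⋯ → N 1 → N 0 → M`. [folklore] -/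
def towerHom {k K : Type u} [Field k] [Field K] [Algebra k K] {M : ProperModel k K}
    (N : ℕ → ProperModel k K) (φ : ∀ m, (N (m + 1)).Hom (N m)) (ψ : (N 0).Hom M) :
    ∀ m, (N m).Hom M
  | 0 => ψ
  | m + 1 => (φ m).comp (towerHom N φ ψ m)

/-- **TowerCompactness** (birth's `stub_towerCompactness`, now a theorem modulo the three Zariski-space
stubs): a `RegLe` tower of proper models over `M` on which every dimension-zero valuation ring has a
regular centre at some stage resolves `M`. The loci `U_m = {v : centre of v on N_m regular}` are open
(`stub_regCentreOpen`), increase with `m` (`RegCentre.of_hom`), and cover `Zar(K/k)` (every `w`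
specialises to a closed point `v ≤ w`, `exists_le_isClosed`, which is dimension-zero,
`stub_closedPointDimZero`, and regular centres generise, `stub_regCentreGeneric`); Zariski's compactness
theorem (`ZariskiRiemannSpace.compactSpace`) gives one `m` with `U_m = Zar(K/k)`, so `N_m` is regular
(`isRegular_of_forall_regCentre`) and `N_m → M` is a resolution (`Hom.hasResolution`).
[cite: ZariskiSamuel1960, Ch. VI §17, Thm. 40] -/
theorem towerCompactness (h₁ : Sig.stub_regCentreOpen) (h₂ : Sig.stub_regCentreGeneric)
    (h₃ : Sig.stub_closedPointDimZero) (h₄ : Sig.stub_centreChart) {k K : Type} [Field k] [Field K] [Algebra k K]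
    (M : ProperModel k K) (N : ℕ → ProperModel k K) (φ : ∀ m, (N (m + 1)).Hom (N m))
    (ψ : (N 0).Hom M) (hφ : ∀ m, (φ m).RegLe)
    (hcov : ∀ v : ZariskiRiemannSpace k K, DimZero k v.asValuationSubring → ∃ m, (N m).RegCentre v) :
    Scheme.HasResolution M.X := by
  classical
  let U : ℕ → Set (ZariskiRiemannSpace k K) := fun m => {v | (N m).RegCentre v}
  have hUo : ∀ m, IsOpen (U m) := fun m => h₁ h₄ k K (N m)
  have hstep : ∀ m v, v ∈ U m → v ∈ U (m + 1) := fun m v hv =>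
    ProperModel.RegCentre.of_hom (φ m) (hφ m) hv
  have hmono : ∀ {m m' : ℕ}, m ≤ m' → U m ⊆ U m' := by
    intro m m' hle v hv
    induction hle with
    | refl => exact hv
    | step _ ih => exact hstep _ v ih
  have hcover : ∀ w : ZariskiRiemannSpace k K, ∃ m, w ∈ U m := by
    intro w
    obtain ⟨v, hvw, hvc⟩ := ZariskiRiemannSpace.exists_le_isClosed w
    obtain ⟨m, hm⟩ := hcov v (h₃ k K v hvc)
    exact ⟨m, h₂ h₄ k K (N m) v w hvw hm⟩
  obtain ⟨t, ht⟩ := isCompact_univ.elim_finite_subcover U hUo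
    (fun w _ => Set.mem_iUnion.mpr (hcover w))
  let m₀ : ℕ := t.sup id
  have hall : ∀ v : ZariskiRiemannSpace k K, (N m₀).RegCentre v := by
    intro v
    have hv : v ∈ ⋃ m ∈ t, U m := ht (Set.mem_univ v)
    obtain ⟨m, hmt, hvm⟩ := Set.mem_iUnion₂.mp hv
    have hle : m ≤ m₀ := Finset.le_sup (f := id) hmt
    exact hmono hle hvm
  exact (towerHom N φ ψ m₀).hasResolution (ProperModel.isRegular_of_forall_regCentre hall)

/-! ## OneTower -/

/-- **ONE TOWER in characteristic `p`** (Zariski-locality of the syzygy-flattening operator Φ): for every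
field `k` of characteristic `p`, every field `K ⊇ k` and every proper model `M` of `K/k`, there is a tower
of proper models `N : ℕ → ProperModel k K` with dominations `φ m : N (m+1) → N m` and `N 0 → M` such that
(a) each `φ m` is `RegLe`, and (b) for every DIMENSION-ZERO valuation ring `v ∈ Zar(K/k)` some finitely
generated `A ⊆ 𝒪_v` with `Frac A = K` has `tower 𝒪_v A m ≃+* 𝒪_(N m, centre v)` for ALL `m`.
(Birth's intermediate object, with the tower by its landed name `tower`.)
[cite: Villamayor2006Flattening, Thm. 1.1 (flattening by blowing up); ZariskiSamuel1960, Ch. VI §17] -/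
def OneTower (p : ℕ) : Prop :=
  ∀ (k K : Type) [Field k] [CharP k p] [Field K] [Algebra k K] (M : ProperModel k K),
    ∃ (N : ℕ → ProperModel k K) (φ : ∀ m, (N (m + 1)).Hom (N m)) (_ : (N 0).Hom M),
      (∀ m, (φ m).RegLe) ∧
      ∀ v : ZariskiRiemannSpace k K, DimZero k v.asValuationSubring →
        ∃ A : Subalgebra k K, A.FG ∧ IsFractionRing ↥A K ∧
          A.toSubring ≤ v.asValuationSubring.toSubring ∧
          ∀ m : ℕ, Nonempty (↥(tower v.asValuationSubring A m) ≃+*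
            ((N m).X.presheaf.stalk ((N m).centre v)))

section OneStep

variable {k K : Type} [Field k] [Field K] [Algebra k K]

/-- Every point of a proper model is the centre of some valuation ring of `K/k`. [folklore] -/
theorem exists_eq_centre (M : ProperModel k K) (x : M.X) :
    ∃ v : ZariskiRiemannSpace k K, x = M.centre v := by
  have hgen : IsGenericPoint M.toKModel.genericPt (Set.univ : Set M.X) := by
    rw [M.genericPt_eq']
    exact genericPoint_spec M.X
  obtain ⟨v, hv⟩ := M.toKModel.exists_isCentre_of_isGenericPoint hgen x
  exact ⟨v, ProperModel.eq_centre_of_isCentre hv⟩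

/-- Some affine open contains the centre. [folklore] -/
theorem exists_isAffineOpen_mem (M : ProperModel k K) (x : M.X) :
    ∃ U : M.X.Opens, IsAffineOpen U ∧ x ∈ U := by
  obtain ⟨_, ⟨U, hU, rfl⟩, hxU, -⟩ :=
    M.X.isBasis_affineOpens.exists_subset_of_mem_open (Set.mem_univ x) isOpen_univ
  exact ⟨U, hU, hxU⟩

/-- Consequences of `stub_centreChart` at a centre: injectivity of `𝒪_{M,x} → K` and a finitely generated
chart `A ⊆ 𝒪_v` with `Frac A = K` and `locAt 𝒪_v A` = the local ring in `K`. [folklore] -/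
theorem exists_chart (h₄ : Sig.stub_centreChart) (M : ProperModel k K) (v : ZariskiRiemannSpace k K) :
    Function.Injective ((M.X.presheaf.stalkSpecializes (genericPoint_specializes (M.centre v)) ≫
        M.funFieldIso.hom).hom) ∧
      ∃ A : Subalgebra k K, A.FG ∧ IsFractionRing ↥A K ∧
        A.toSubring ≤ v.asValuationSubring.toSubring ∧
        (locAt v.asValuationSubring A).toSubring = stalkRange M (M.centre v) := by
  obtain ⟨U, hU, hx⟩ := exists_isAffineOpen_mem M (M.centre v)
  obtain ⟨hinj, A, -, hfg, hfr, hle, hloc⟩ := h₄ k K M v U hU hx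
  exact ⟨hinj, A, hfg, hfr, hle, hloc⟩

/-- The local ring at a centre, in `K`, lies in `𝒪_v`. [folklore] -/
theorem stalkRange_le (h₄ : Sig.stub_centreChart) (M : ProperModel k K) (v : ZariskiRiemannSpace k K) :
    stalkRange M (M.centre v) ≤ v.asValuationSubring.toSubring := by
  obtain ⟨-, A, -, -, hle, hloc⟩ := exists_chart h₄ M v
  rw [← hloc]
  exact locAt_toSubring_le v.asValuationSubring v.algebraMap_mem hle

/-- A subalgebra whose underlying subring is the local ring at `x` in `K` is ring-isomorphic to the
stalk `𝒪_{M,x}` (injectivity of `𝒪_{M,x} → K`). [folklore] -/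
theorem nonempty_ringEquiv_stalk (M : ProperModel k K) (x : M.X)
    (hinj : Function.Injective ((M.X.presheaf.stalkSpecializes (genericPoint_specializes x) ≫
        M.funFieldIso.hom).hom))
    (B : Subalgebra k K) (hB : B.toSubring = stalkRange M x) :
    Nonempty (↥B ≃+* M.X.presheaf.stalk x) := by
  set f := (M.X.presheaf.stalkSpecializes (genericPoint_specializes x) ≫ M.funFieldIso.hom).hom
  have hbij : Function.Bijective f.rangeRestrict :=
    ⟨fun a b h => hinj (congrArg Subtype.val h), f.rangeRestrict_surjective⟩
  let e₁ : M.X.presheaf.stalk x ≃+* f.range := RingEquiv.ofBijective f.rangeRestrict hbij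
  have hB' : ∀ y : K, y ∈ B ↔ y ∈ f.range := fun y => by
    change y ∈ B.toSubring ↔ _
    rw [hB]
  let e₂ : ↥B ≃+* f.range :=
    { toFun := fun y => ⟨y.1, (hB' y.1).mp y.2⟩
      invFun := fun y => ⟨y.1, (hB' y.1).mpr y.2⟩
      left_inv := fun _ => rfl
      right_inv := fun _ => rfl
      map_mul' := fun _ _ => rfl
      map_add' := fun _ _ => rfl }
  exact ⟨e₂.trans e₁.symm⟩

/-- `Frac B = K` for any `k`-subalgebra `B` of `K` containing one with `Frac = K`. [folklore] -/
theorem isFractionRing_of_le {A B : Subalgebra k K} (hAB : A ≤ B) [hA : IsFractionRing ↥A K] :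
    IsFractionRing ↥B K := by
  refine IsFractionRing.of_field (↥B) K fun z => ?_
  obtain ⟨a, b, -, rfl⟩ := IsFractionRing.div_surjective (A := ↥A) z
  exact ⟨⟨(a : K), hAB a.2⟩, ⟨(b : K), hAB b.2⟩, rfl⟩

/-- **ONE STEP of Φ on proper models** (from `stub_syzygyBlowupStage`, `stub_normalizationStage`,
`stub_centreChart` and the landed local algebra): for every proper model `M` there is `M' → M`, `RegLe`,
whose local ring at the centre of every `v`, in `K`, is `step 𝒪_v B` for `B` the local ring of `M` at the
centre of `v`. The stalk identity: `step 𝒪_v B = locAt (nrm (chart B)) = locAt (nrm (locAt (chart B)))`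
(`stub_nrm_locAt`) and the two stages compute `locAt (chart B)` resp. `locAt (nrm ·)`. `RegLe`: a point
`y` over a regular `x` is the centre of some `w`; the local ring `B` of `x` is regular, so `step 𝒪_w B = B`
(`stub_regularStep`), i.e. `𝒪_{M',y} ≅ B ≅ 𝒪_{M,x}` is regular.
[cite: Villamayor2006Flattening, Thm. 1.1 (flattening by blowing up)] -/
theorem oneStep (h₄ : Sig.stub_centreChart) (h₅ : Sig.stub_syzygyBlowupStage)
    (h₆ : Sig.stub_normalizationStage) (h₇ : Sig.stub_datumBlowup) (M : ProperModel k K) :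
    ∃ (M' : ProperModel k K) (φ : M'.Hom M), φ.RegLe ∧
      ∀ (v : ZariskiRiemannSpace k K) (B : Subalgebra k K),
        B.toSubring = stalkRange M (M.centre v) →
        (step v.asValuationSubring B).toSubring = stalkRange M' (M'.centre v) := by
  obtain ⟨M₁, φ₁, hM₁⟩ := h₅ h₄ h₇ k K M
  obtain ⟨M₂, φ₂, hM₂⟩ := h₆ h₄ k K M₁
  have hstalk : ∀ (v : ZariskiRiemannSpace k K) (B : Subalgebra k K),
      B.toSubring = stalkRange M (M.centre v) →
      (step v.asValuationSubring B).toSubring = stalkRange M₂ (M₂.centre v) := by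
    intro v B hB
    set O := v.asValuationSubring
    have hk : ∀ c : k, algebraMap k K c ∈ O := v.algebraMap_mem
    have hBO : B.toSubring ≤ O.toSubring := by rw [hB]; exact stalkRange_le h₄ M v
    have hCO : (chart O B).toSubring ≤ O.toSubring := chart_toSubring_le O hk hBO
    have e₁ := hM₁ v B hB
    have e₂ := hM₂ v (locAt O (chart O B)) e₁
    rw [step_def, ← stub_nrm_locAt k K O (chart O B) hk hCO]
    exact e₂
  refine ⟨M₂, φ₂.comp φ₁, ?_, hstalk⟩
  -- `RegLe`
  intro y hreg
  obtain ⟨w, rfl⟩ := exists_eq_centre M₂ y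
  have hx : (φ₂.comp φ₁).f (M₂.centre w) = M.centre w := ProperModel.Hom.map_centre _ w
  rw [hx] at hreg
  set O := w.asValuationSubring
  obtain ⟨hinjM, A, -, hfr, hAO, hloc⟩ := exists_chart h₄ M w
  set B : Subalgebra k K := locAt O A
  have hk : ∀ c : k, algebraMap k K c ∈ O := w.algebraMap_mem
  have hBO : B.toSubring ≤ O.toSubring := locAt_toSubring_le O hk hAO
  haveI : IsFractionRing ↥B K := isFractionRing_of_le (self_le_locAt O A)
  obtain ⟨eB⟩ := nonempty_ringEquiv_stalk M (M.centre w) hinjM B hloc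
  haveI : IsRegularLocalRing ↥B := by
    haveI := hreg
    exact IsRegularLocalRing.of_ringEquiv eB.symm
  have hfix : step O B = B :=
    stub_regularStep k K O B hk hBO ‹_› (locAt_locAt O A hAO) ‹_›
  have hst : (step O B).toSubring = stalkRange M₂ (M₂.centre w) := hstalk w B hloc
  rw [hfix] at hst
  obtain ⟨hinj₂, -⟩ := exists_chart h₄ M₂ w
  obtain ⟨e₂⟩ := nonempty_ringEquiv_stalk M₂ (M₂.centre w) hinj₂ B hst
  exact IsRegularLocalRing.of_ringEquiv (eB.symm.trans e₂)

/-- **`OneTower p` from the stubs** (induction on the stage: `N 0 = M`, `N (m+1) = Φ(N m)` with Φ the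
one step `oneStep`; the chart `A` of `stub_centreChart` at the centre of `v` on `M` starts the induction,
`tower_zero` / `tower_succ'` drive it, and injectivity of `𝒪 → K` turns equal subrings of `K` into ring
isomorphisms). The characteristic and the dimension-zero hypothesis are not used. [folklore] -/
theorem oneTower_of (h₄ : Sig.stub_centreChart) (h₅ : Sig.stub_syzygyBlowupStage)
    (h₆ : Sig.stub_normalizationStage) (h₇ : Sig.stub_datumBlowup) (p : ℕ) : OneTower p := by
  intro k K _ _ _ _ M
  classical
  choose Φ Φhom hΦreg hΦst using fun X : ProperModel k K => oneStep h₄ h₅ h₆ h₇ X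
  let N : ℕ → ProperModel k K := fun m => Nat.rec M (fun _ X => Φ X) m
  have hN0 : N 0 = M := rfl
  have hNs : ∀ m, N (m + 1) = Φ (N m) := fun m => rfl
  refine ⟨N, fun m => hNs m ▸ Φhom (N m), hN0 ▸ ProperModel.Hom.id M, fun m => ?_, fun v _ => ?_⟩
  · change ((Φhom (N m)) : (N (m + 1)).Hom (N m)).RegLe
    exact hΦreg (N m)
  · obtain ⟨_, A, hfg, hfr, hAO, hloc⟩ := exists_chart h₄ M v
    refine ⟨A, hfg, hfr, hAO, fun m => ?_⟩
    have htower : ∀ m, (tower v.asValuationSubring A m).toSubring =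
        stalkRange (N m) ((N m).centre v) := by
      intro m
      induction m with
      | zero => rw [tower_zero]; exact hloc
      | succ m ih =>
        rw [tower_succ']
        exact hΦst (N m) v (tower v.asValuationSubring A m) ih
    obtain ⟨hinj, -⟩ := exists_chart h₄ (N m) v
    exact nonempty_ringEquiv_stalk (N m) ((N m).centre v) hinj _ (htower m)

end OneStep

/-! ## Proper models suffice (birth, PROVED) -/

/-- **An integral projective variety over a field of characteristic `p` has a resolution as soon as
every proper model of every function field does** (birth). [cite: ZariskiSamuel1960, Ch. VI §17] -/
theorem hasResolution_projective_of_forall_properModel {p : ℕ}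
    (h : ∀ (k K : Type) [Field k] [CharP k p] [Field K] [Algebra k K] (M : ProperModel k K),
      Scheme.HasResolution M.X)
    {k : Type} [Field k] [CharP k p] {n : ℕ} (X : Scheme.{0}) [IsIntegral X]
    (ι : X ⟶ (Motives.projectiveSpace n k).left) [IsClosedImmersion ι] :
    Scheme.HasResolution X := by
  classical
  haveI : IsProper (Motives.projectiveSpace n k).hom := Motives.isProper_projectiveSpace n k
  let πX : X ⟶ Spec (.of k) := ι ≫ (Motives.projectiveSpace n k).hom
  have hproj : Motives.IsProjectiveOver (Over.mk πX) := ⟨n, Over.homMk ι rfl, ‹_›⟩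
  haveI : LocallyOfFiniteType πX := inferInstance
  obtain ⟨_, ⟨U', hU', rfl⟩, hηU, -⟩ := X.isBasis_affineOpens.exists_subset_of_mem_open
    (Set.mem_univ (genericPoint X)) isOpen_univ
  let U : X.Opens := U'
  have hU : IsAffineOpen U := hU'
  haveI : IsAffine U := hU
  haveI : Nonempty U := ⟨⟨_, hηU⟩⟩
  let A : Type := Γ(U, ⊤)
  let g : (U : Scheme.{0}) ⟶ Spec (.of k) := U.ι ≫ πX
  let ψ : k →+* A := g.appTop.hom.comp (Scheme.ΓSpecIso (.of k)).inv.hom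
  have hψ : ψ.FiniteType := by
    have h1 : g.appTop.hom.FiniteType :=
      (HasRingHomProperty.iff_of_isAffine (P := @LocallyOfFiniteType)).mp inferInstance
    exact h1.comp (RingHom.FiniteType.of_surjective _
      (Scheme.ΓSpecIso (.of k)).symm.commRingCatIsoToRingEquiv.surjective)
  letI : Algebra k A := ψ.toAlgebra
  haveI hft : Algebra.FiniteType k A := hψ
  let K : Type := FractionRing A
  let j : Spec (.of A) ⟶ X := U.toScheme.isoSpec.inv ≫ U.ι
  have hj : j ≫ πX = Spec.map (CommRingCat.ofHom (algebraMap k A)) := by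
    change (U.toScheme.isoSpec.inv ≫ U.ι) ≫ πX = Spec.map (CommRingCat.ofHom ψ)
    rw [Category.assoc, isoSpec_inv_comp]
    rfl
  let M₀ : ProjModel k K := ProjModel.ofChart (K := K) X πX hproj A j hj
  exact h k K M₀.toProperModel

/-- **Proper models suffice**: if every proper model of every function field over every field of
characteristic `p` has a resolution, then `ResolutionInChar p` (birth; components, Chow, projective
closure — `ResolutionOverUpToDim.of_projective`). [cite: CossartPiltant2019, Prop. 4.6 (proof, Steps 1–3)] -/
theorem resolutionInChar_of_forall_properModel (p : ℕ)
    (h : ∀ (k K : Type) [Field k] [CharP k p] [Field K] [Algebra k K] (M : ProperModel k K),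
      Scheme.HasResolution M.X) :
    ResolutionInChar.{0} p := by
  intro k _ _ X f hs hl hq hr
  haveI : QuasiCompact f := hq
  haveI : LocallyOfFiniteType f := hl
  haveI : CompactSpace X := QuasiCompact.compactSpace_of_compactSpace f
  obtain ⟨d, hd⟩ := exists_topologicalKrullDim_le_of_locallyOfFiniteType f
  refine (ResolutionOverUpToDim.of_projective (k := k) (d := d) fun n Y ι hι hY _ => ?_)
    X f hs hl hq hr hd
  haveI := hι
  haveI := hY
  exact hasResolution_projective_of_forall_properModel h Y ι

/-! ## The composition (kernel-checked) -/

/-- **`Globalisation` from the five remaining stub statements** — the six landed stubs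
(`stub_regCentreOpen`, `stub_regCentreGeneric`, `stub_closedPointDimZero`, `stub_centreChart`,
`stub_normalizationStage`, `stub_datumBlowup`) are supplied by their imported theorems; the syzygy
blow-up stage by `syzygyBlowupStage_of`. At a prime `p`, for a proper model `M` take the ONE TOWER
(`oneTower_of`); for a dimension-zero `v` its chart `A`; the crux hypothesis (read through
`globalisation_iff`, `TowerTerminates`) gives an `m` with `tower 𝒪_v A m` regular; transport along the
pinned ring isomorphism to the stalk of `N m` at the centre of `v`; `towerCompactness` resolves `M`;
`resolutionInChar_of_forall_properModel` concludes. [cite: ZariskiSamuel1960, Ch. VI §17] -/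
theorem Globalisation_of (t₁ : Sig.stub_syzygyDatumExists) (t₂ : Sig.stub_affineRes)
    (t₃ : Sig.stub_syzygyDatumCompat) (t₄ : Sig.stub_syzygyDatumChart)
    (t₅ : Sig.stub_datumBlowupStalk) : Globalisation := by
  have h₁ : Sig.stub_regCentreOpen := stub_regCentreOpen
  have h₂ : Sig.stub_regCentreGeneric := stub_regCentreGeneric
  have h₃ : Sig.stub_closedPointDimZero := stub_closedPointDimZero
  have h₄ : Sig.stub_centreChart := stub_centreChart
  have h₅ : Sig.stub_syzygyBlowupStage := syzygyBlowupStage_of t₁ t₂ t₃ t₄ t₅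
  have h₆ : Sig.stub_normalizationStage := stub_normalizationStage
  have h₇ : Sig.stub_datumBlowup := stub_datumBlowup
  refine globalisation_iff.mpr fun p hp hT => ?_
  refine resolutionInChar_of_forall_properModel p fun k K _ _ _ _ M => ?_
  obtain ⟨N, φ, ψ, hφ, hpin⟩ := oneTower_of h₄ h₅ h₆ h₇ p k K M
  refine towerCompactness h₁ h₂ h₃ h₄ M N φ ψ hφ fun v hv => ?_
  obtain ⟨A, hA, hF, hAO, he⟩ := hpin v hv
  obtain ⟨m, hm⟩ := hT k K v.asValuationSubring A v.algebraMap_mem hA hF hAO hv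
  obtain ⟨e⟩ := he m
  haveI := hm
  exact ⟨m, IsRegularLocalRing.of_ringEquiv e⟩

/-- **The crux `Globalisation`, assembled from the five registered stubs** (the only `sorry`s in its
closure are the `stub_*` of section `SyzygyStubs`). -/
theorem Globalisation_proof : Globalisation :=
  Globalisation_of stub_syzygyDatumExists stub_affineRes stub_syzygyDatumCompat stub_syzygyDatumChart
    stub_datumBlowupStalk

end Summit.ResolutionOfSingularities.ResolutionOfSingularities.Theorems.SyzygyFlattening

end
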